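import Summits.Parity.GeneralizedHardyLittlewood.Theorems.LeeYangFibresCellParityLawDefs
import Literature.NumberTheory.Sieve.LinearEquationsInPrimesSingularSeries
import Literature.NumberTheory.Sieve.PairShiuRough
import Literature.NumberTheory.Sieve.BrunGoldbach
import HarnessLib

/-!
# Route `LeeYangFibres`, crux `CellParityLaw` (stmt-Parity-14109), line `section-annihilator`:
# the registered stub `stub_singularRatio` — singular-series bookkeeping

We prove `SingularRatioBound` (vocabulary file `LeeYangFibresCellParityLawDefs`): for a
non-degenerate one-dimensional system `Ψ = (ψ₀, …, ψ_t)` of `t + 1` affine-linear forms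
`ψ_k(n) = a_k n + b_k` of size `‖Ψ‖_N ≤ L`, and a deleted coordinate `i` (sub-system
`Ψ₋ᵢ = Fin.removeNth i Ψ`),

* `0 ≤ 𝔖(Ψ₋ᵢ)` and `0 ≤ 𝔖(Ψ)` — the singular products are limits (Green–Tao 2010, Lemma 1.3,
  the tree's `tendsto_singularProductPartial_holds`) of products of local factors `β_p ≥ 0`;
* `𝔖(Ψ) ≤ C (log log N) 𝔖(Ψ₋ᵢ)` for `N ≥ N₀(t, L)`, with `C = 3⁹ + 4e⁵(t + 1)` (exponent `D = 1`).

Proof of the ratio bound (Green–Tao 2010, proof of Lemma 1.3, bookkeeping). At a prime `p`,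
`β_p(Ψ) = p⁻¹ (p/(p-1))^{t+1} g_p(Ψ)` with `g_p(Ψ) = #{v mod p : p ∤ ψ_k(v) ∀ k}` (the tree's
`localFactor_prime`, `goodCount`). Always `g_p(Ψ) ≤ g_p(Ψ₋ᵢ)`, whence
`β_p(Ψ) ≤ (p/(p-1)) β_p(Ψ₋ᵢ)`; and if `ψ_i` has a root mod `p` at which no other form vanishes,
then `g_p(Ψ) + 1 ≤ g_p(Ψ₋ᵢ) ≤ p` and `β_p(Ψ) ≤ β_p(Ψ₋ᵢ)`. The second case occurs for every prime
not dividing `Δ = |a_i| ∏_{k ≠ i} |a_i b_k - a_k b_i|`, a NON-ZERO integer by non-degeneracy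
(`a_i ≠ 0`; `a_i b_k = a_k b_i` would make `a_k ψ_i = a_i ψ_k`). Hence, prime by prime,
`∏_{p ≤ x} β_p(Ψ) ≤ (∏_{p ∣ Δ} p/(p-1)) ∏_{p ≤ x} β_p(Ψ₋ᵢ) = (Δ/φ(Δ)) ∏_{p ≤ x} β_p(Ψ₋ᵢ)`, and in the
limit `𝔖(Ψ) ≤ (Δ/φ(Δ)) 𝔖(Ψ₋ᵢ)`. Finally `|a_k| ≤ L`, `|b_k| ≤ L N` give `Δ ≤ L (2L²N)^t ≤ 2N^{t+1}`
for `N ≥ L(2L²)^t`, and Landau's `m/φ(m) ≪ log log m` in the tree's explicit form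
(`BrunGoldbach.self_div_totient_le`: `m/φ(m) ≤ 3⁹ + 4e⁵ log log M` for `m ≤ 2M`) with `M = N^{t+1}`,
`log log N^{t+1} ≤ t + log log N`, gives the claim once `log log N ≥ 1` (`N ≥ e^e`).

The empty sub-system (`t = 0`) needs no special treatment: `g_p(∅) = p`, `β_p(∅) = 1`.

References: B. Green, T. Tao, *Linear equations in primes*, Ann. of Math. 171 (2010), Lemma 1.3 and
(1.6) [GreenTao2010]; G. H. Hardy, E. M. Wright, Thm 328 (Landau's totient bound) [HardyWright2008].
-/

noncomputable section

open scoped BigOperators Topology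
open Finset Filter Literature.NumberTheory.Sieve

namespace Summit.Parity.GeneralizedHardyLittlewood.Cruxes.CellParityLaw.SectionAnnihilator

namespace SingularRatio

variable {t : ℕ}

/-! ## Sub-systems and non-negativity -/

/-- Deleting a form preserves Green–Tao non-degeneracy: `Fin.removeNth i Ψ k = Ψ (i.succAbove k)`
and `i.succAbove` is injective. [folklore] -/
theorem isNondegenerateSystem_removeNth {d s : ℕ} {Ψ : Fin (s + 1) → AffLinForm d}
    (h : IsNondegenerateSystem Ψ) (i : Fin (s + 1)) :
    IsNondegenerateSystem (Fin.removeNth i Ψ) :=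
  ⟨fun k => h.1 (i.succAbove k), fun k l hkl a b hab =>
    h.2 (i.succAbove k) (i.succAbove l) (fun heq => hkl (Fin.succAbove_right_injective heq))
      a b hab⟩

/-- The partial singular products `∏_{p ≤ x} β_p` are non-negative (`β_p ≥ 0`). [folklore] -/
theorem singularProductPartial_nonneg {d s : ℕ} (Ψ : Fin s → AffLinForm d) (x : ℕ) :
    0 ≤ singularProductPartial Ψ x :=
  Finset.prod_nonneg fun p _ => localFactor_nonneg Ψ p

/-- The singular product of a non-degenerate system is non-negative: it is the limit
(Green–Tao 2010, Lemma 1.3) of the non-negative partial products. [folklore] -/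
theorem singularProduct_nonneg {d s : ℕ} {Ψ : Fin s → AffLinForm d}
    (h : IsNondegenerateSystem Ψ) : 0 ≤ singularProduct Ψ :=
  ge_of_tendsto' (tendsto_singularProductPartial_holds d s Ψ h)
    fun x => singularProductPartial_nonneg Ψ x

/-! ## The local factors of `Ψ` and `Ψ₋ᵢ` at a prime -/

/-- A one-dimensional form mod `p`: `ψ_p(v) = a v₀ + b`. [folklore] -/
theorem modEval_one (ψ : AffLinForm 1) (p : ℕ) (v : Fin 1 → ZMod p) :
    ψ.modEval p v = (ψ.coeff 0 : ZMod p) * v 0 + (ψ.const : ZMod p) := by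
  simp [AffLinForm.modEval]

/-- `g_p(Ψ) ≤ g_p(Ψ₋ᵢ)`: a residue good for all forms is good for the sub-system. [folklore] -/
theorem goodCount_le_removeNth (Ψ : Fin (t + 1) → AffLinForm 1) (i : Fin (t + 1)) (p : ℕ)
    [NeZero p] : goodCount Ψ p ≤ goodCount (Fin.removeNth i Ψ) p := by
  unfold goodCount
  refine Finset.card_le_card fun v hv => ?_
  simp only [Finset.mem_filter, Finset.mem_univ, true_and] at hv ⊢
  exact fun k => hv (i.succAbove k)

/-- `g_p(Ψ) < g_p(Ψ₋ᵢ)` as soon as some residue is a zero of `ψ_i` but of no other form.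
[folklore] -/
theorem goodCount_lt_removeNth (Ψ : Fin (t + 1) → AffLinForm 1) (i : Fin (t + 1)) (p : ℕ)
    [NeZero p] {v : Fin 1 → ZMod p} (hv : (Ψ i).modEval p v = 0)
    (hv' : ∀ k : Fin t, (Ψ (i.succAbove k)).modEval p v ≠ 0) :
    goodCount Ψ p < goodCount (Fin.removeNth i Ψ) p := by
  unfold goodCount
  refine Finset.card_lt_card ((Finset.ssubset_iff_of_subset fun w hw => ?_).mpr ⟨v, ?_, ?_⟩)
  · simp only [Finset.mem_filter, Finset.mem_univ, true_and] at hw ⊢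
    exact fun k => hw (i.succAbove k)
  · simp only [Finset.mem_filter, Finset.mem_univ, true_and]
    exact hv'
  · simp only [Finset.mem_filter, Finset.mem_univ, true_and, not_forall, not_not]
    exact ⟨i, hv⟩

/-- Always `β_p(Ψ) ≤ (p/(p-1)) · β_p(Ψ₋ᵢ)` (from `g_p(Ψ) ≤ g_p(Ψ₋ᵢ)`).
[cite: GreenTao2010, proof of Lemma 1.3] -/
theorem localFactor_le_mul_removeNth (Ψ : Fin (t + 1) → AffLinForm 1) (i : Fin (t + 1))
    {p : ℕ} (hp : p.Prime) :
    localFactor Ψ p ≤ (p : ℝ) / (p - 1) * localFactor (Fin.removeNth i Ψ) p := by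
  haveI := Fact.mk hp
  have hp2 : (2 : ℝ) ≤ p := by exact_mod_cast hp.two_le
  have hr : 0 ≤ (p : ℝ) / (p - 1) := div_nonneg (by linarith) (by linarith)
  have hg : (goodCount Ψ p : ℝ) ≤ goodCount (Fin.removeNth i Ψ) p := by
    exact_mod_cast goodCount_le_removeNth Ψ i p
  rw [localFactor_prime, localFactor_prime, pow_succ _ t]
  calc ((p : ℝ) ^ 1)⁻¹ * (((p : ℝ) / (p - 1)) ^ t * ((p : ℝ) / (p - 1)) * goodCount Ψ p)
      ≤ ((p : ℝ) ^ 1)⁻¹ * (((p : ℝ) / (p - 1)) ^ t * ((p : ℝ) / (p - 1)) *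
          goodCount (Fin.removeNth i Ψ) p) :=
        mul_le_mul_of_nonneg_left (mul_le_mul_of_nonneg_left hg (mul_nonneg (pow_nonneg hr t) hr))
          (by positivity)
    _ = (p : ℝ) / (p - 1) * (((p : ℝ) ^ 1)⁻¹ * (((p : ℝ) / (p - 1)) ^ t *
          goodCount (Fin.removeNth i Ψ) p)) := by ring

/-- With an unshared root of `ψ_i` mod `p`: `β_p(Ψ) ≤ β_p(Ψ₋ᵢ)`
(`(p/(p-1)) (g - 1) ≤ g` for `g = g_p(Ψ₋ᵢ) ≤ p`). [cite: GreenTao2010, proof of Lemma 1.3] -/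
theorem localFactor_le_removeNth_of_root (Ψ : Fin (t + 1) → AffLinForm 1) (i : Fin (t + 1))
    {p : ℕ} (hp : p.Prime) (hw : ∃ v : Fin 1 → ZMod p, (Ψ i).modEval p v = 0 ∧
      ∀ k : Fin t, (Ψ (i.succAbove k)).modEval p v ≠ 0) :
    localFactor Ψ p ≤ localFactor (Fin.removeNth i Ψ) p := by
  haveI := Fact.mk hp
  obtain ⟨v, hv, hv'⟩ := hw
  have hp2 : (2 : ℝ) ≤ p := by exact_mod_cast hp.two_le
  have hr : 0 ≤ (p : ℝ) / (p - 1) := div_nonneg (by linarith) (by linarith)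
  have hg : (goodCount Ψ p : ℝ) + 1 ≤ goodCount (Fin.removeNth i Ψ) p := by
    exact_mod_cast goodCount_lt_removeNth Ψ i p hv hv'
  have hg' : (goodCount (Fin.removeNth i Ψ) p : ℝ) ≤ p := by
    have h1 : goodCount (Fin.removeNth i Ψ) p ≤ Fintype.card (Fin 1 → ZMod p) :=
      Finset.card_le_univ _
    rw [card_zmod_pow, pow_one] at h1
    exact_mod_cast h1
  rw [localFactor_prime, localFactor_prime, pow_succ _ t]
  refine mul_le_mul_of_nonneg_left ?_ (by positivity)
  rw [mul_assoc]
  refine mul_le_mul_of_nonneg_left ?_ (pow_nonneg hr t)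
  rw [div_mul_eq_mul_div, div_le_iff₀ (by linarith : (0 : ℝ) < p - 1)]
  nlinarith [mul_le_mul_of_nonneg_left hg (by linarith : (0 : ℝ) ≤ p)]

/-- If `p ∤ a_i` and `p ∤ a_i b_k - a_k b_i` for all `k ≠ i`, the root `-b_i/a_i` of `ψ_i`
mod `p` is a zero of no other form. [cite: GreenTao2010, proof of Lemma 1.3] -/
theorem exists_root (Ψ : Fin (t + 1) → AffLinForm 1) (i : Fin (t + 1)) {p : ℕ} [Fact p.Prime]
    (ha : (((Ψ i).coeff 0 : ℤ) : ZMod p) ≠ 0)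
    (hD : ∀ k : Fin t, (((Ψ i).coeff 0 * (Ψ (i.succAbove k)).const -
      (Ψ (i.succAbove k)).coeff 0 * (Ψ i).const : ℤ) : ZMod p) ≠ 0) :
    ∃ v : Fin 1 → ZMod p, (Ψ i).modEval p v = 0 ∧
      ∀ k : Fin t, (Ψ (i.succAbove k)).modEval p v ≠ 0 := by
  have hAA : ((Ψ i).coeff 0 : ZMod p) * ((Ψ i).coeff 0 : ZMod p)⁻¹ = 1 := mul_inv_cancel₀ ha
  refine ⟨fun _ => -((Ψ i).const : ZMod p) * ((Ψ i).coeff 0 : ZMod p)⁻¹, ?_, fun k hk => ?_⟩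
  · simp only [modEval_one]
    linear_combination (-((Ψ i).const : ZMod p)) * hAA
  · refine hD k ?_
    simp only [modEval_one] at hk
    push_cast
    linear_combination ((Ψ i).coeff 0 : ZMod p) * hk +
      (((Ψ (i.succAbove k)).coeff 0 : ZMod p) * ((Ψ i).const : ZMod p)) * hAA

/-- For a prime `p` not dividing (a multiple `Δ` of) `|a_i|` and all `|a_i b_k - a_k b_i|`:
`β_p(Ψ) ≤ β_p(Ψ₋ᵢ)`. [cite: GreenTao2010, proof of Lemma 1.3] -/
theorem localFactor_le_removeNth_of_not_dvd (Ψ : Fin (t + 1) → AffLinForm 1) (i : Fin (t + 1))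
    {Δ : ℕ} (hΔa : ((Ψ i).coeff 0).natAbs ∣ Δ)
    (hΔD : ∀ k : Fin t, ((Ψ i).coeff 0 * (Ψ (i.succAbove k)).const -
      (Ψ (i.succAbove k)).coeff 0 * (Ψ i).const).natAbs ∣ Δ)
    {p : ℕ} (hp : p.Prime) (hpΔ : ¬ p ∣ Δ) :
    localFactor Ψ p ≤ localFactor (Fin.removeNth i Ψ) p := by
  haveI := Fact.mk hp
  refine localFactor_le_removeNth_of_root Ψ i hp (exists_root Ψ i (fun h => hpΔ ?_) fun k h => hpΔ ?_)
  · exact (Int.natCast_dvd.mp ((ZMod.intCast_zmod_eq_zero_iff_dvd _ p).mp h)).trans hΔa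
  · exact (Int.natCast_dvd.mp ((ZMod.intCast_zmod_eq_zero_iff_dvd _ p).mp h)).trans (hΔD k)

/-! ## Partial products and the limit -/

/-- Prime by prime: `∏_{p ≤ x} β_p(Ψ) ≤ (Δ/φ(Δ)) ∏_{p ≤ x} β_p(Ψ₋ᵢ)`, using
`Δ/φ(Δ) = ∏_{p ∣ Δ} p/(p-1)`. [cite: GreenTao2010, proof of Lemma 1.3] -/
theorem singularProductPartial_le (Ψ : Fin (t + 1) → AffLinForm 1) (i : Fin (t + 1))
    {Δ : ℕ} (hΔ0 : Δ ≠ 0) (hΔa : ((Ψ i).coeff 0).natAbs ∣ Δ)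
    (hΔD : ∀ k : Fin t, ((Ψ i).coeff 0 * (Ψ (i.succAbove k)).const -
      (Ψ (i.succAbove k)).coeff 0 * (Ψ i).const).natAbs ∣ Δ) (x : ℕ) :
    singularProductPartial Ψ x ≤
      (Δ : ℝ) / Nat.totient Δ * singularProductPartial (Fin.removeNth i Ψ) x := by
  have hr1 : ∀ p : ℕ, p.Prime → (0 : ℝ) ≤ (p : ℝ) / (p - 1) ∧ 1 ≤ (p : ℝ) / (p - 1) := by
    intro p hp
    have hp2 : (2 : ℝ) ≤ p := by exact_mod_cast hp.two_le
    exact ⟨div_nonneg (by linarith) (by linarith), (one_le_div (by linarith)).mpr (by linarith)⟩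
  have hstep : ∀ p ∈ Nat.primesLE x, localFactor Ψ p ≤
      (if p ∣ Δ then (p : ℝ) / (p - 1) else 1) * localFactor (Fin.removeNth i Ψ) p := by
    intro p hp
    have hp' := Nat.prime_of_mem_primesLE hp
    by_cases hpd : p ∣ Δ
    · rw [if_pos hpd]
      exact localFactor_le_mul_removeNth Ψ i hp'
    · rw [if_neg hpd, one_mul]
      exact localFactor_le_removeNth_of_not_dvd Ψ i hΔa hΔD hp' hpd
  calc singularProductPartial Ψ x
      ≤ ∏ p ∈ Nat.primesLE x,
          (if p ∣ Δ then (p : ℝ) / (p - 1) else 1) * localFactor (Fin.removeNth i Ψ) p :=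
        Finset.prod_le_prod (fun p _ => localFactor_nonneg Ψ p) hstep
    _ = (∏ p ∈ Nat.primesLE x, if p ∣ Δ then (p : ℝ) / (p - 1) else 1) *
          singularProductPartial (Fin.removeNth i Ψ) x := Finset.prod_mul_distrib
    _ ≤ (Δ : ℝ) / Nat.totient Δ * singularProductPartial (Fin.removeNth i Ψ) x := by
        refine mul_le_mul_of_nonneg_right ?_ (singularProductPartial_nonneg _ x)
        rw [PairShiu.self_div_totient_eq_prod hΔ0, ← Finset.prod_filter]
        refine Finset.prod_le_prod_of_subset_of_one_le (fun p hp => ?_) (fun p hp => ?_)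
          (fun p hp _ => ?_)
        · rw [Finset.mem_filter] at hp
          exact Nat.mem_primeFactors.mpr ⟨Nat.prime_of_mem_primesLE hp.1, hp.2, hΔ0⟩
        · exact (hr1 p (Nat.prime_of_mem_primesLE (Finset.mem_filter.mp hp).1)).1
        · exact (hr1 p (Nat.prime_of_mem_primeFactors hp)).2

/-- In the limit `x → ∞` (Green–Tao 2010, Lemma 1.3, for `Ψ` and for `Ψ₋ᵢ`):
`𝔖(Ψ) ≤ (Δ/φ(Δ)) 𝔖(Ψ₋ᵢ)`. [cite: GreenTao2010, Lemma 1.3] -/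
theorem singularProduct_le (Ψ : Fin (t + 1) → AffLinForm 1) (hΨ : IsNondegenerateSystem Ψ)
    (i : Fin (t + 1)) {Δ : ℕ} (hΔ0 : Δ ≠ 0) (hΔa : ((Ψ i).coeff 0).natAbs ∣ Δ)
    (hΔD : ∀ k : Fin t, ((Ψ i).coeff 0 * (Ψ (i.succAbove k)).const -
      (Ψ (i.succAbove k)).coeff 0 * (Ψ i).const).natAbs ∣ Δ) :
    singularProduct Ψ ≤ (Δ : ℝ) / Nat.totient Δ * singularProduct (Fin.removeNth i Ψ) :=
  le_of_tendsto_of_tendsto' (tendsto_singularProductPartial_holds 1 (t + 1) Ψ hΨ)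
    ((tendsto_singularProductPartial_holds 1 t _ (isNondegenerateSystem_removeNth hΨ i)).const_mul _)
    fun x => singularProductPartial_le Ψ i hΔ0 hΔa hΔD x

/-! ## The integer `Δ = |a_i| ∏_{k ≠ i} |a_i b_k - a_k b_i|`: non-vanishing and size -/

/-- Non-degeneracy makes `Δ ≠ 0`: `a_i ≠ 0` (the form `ψ_i` is non-constant) and
`a_i b_k - a_k b_i ≠ 0` (else `a_k ψ_i = a_i ψ_k` identically, forcing `a_i = 0`).
[cite: GreenTao2010, Def. 1.1] -/
theorem crossDisc_ne_zero (Ψ : Fin (t + 1) → AffLinForm 1) (hΨ : IsNondegenerateSystem Ψ)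
    (i : Fin (t + 1)) :
    ((Ψ i).coeff 0).natAbs * ∏ k : Fin t, ((Ψ i).coeff 0 * (Ψ (i.succAbove k)).const -
      (Ψ (i.succAbove k)).coeff 0 * (Ψ i).const).natAbs ≠ 0 := by
  have ha : (Ψ i).coeff 0 ≠ 0 := fun h =>
    hΨ.1 i (funext fun j => by rw [Subsingleton.elim j 0]; exact h)
  refine Nat.mul_ne_zero (Int.natAbs_ne_zero.mpr ha)
    (Finset.prod_ne_zero_iff.mpr fun k _ => Int.natAbs_ne_zero.mpr fun h => ?_)
  refine ha (hΨ.2 i (i.succAbove k) (Fin.ne_succAbove i k) ((Ψ (i.succAbove k)).coeff 0)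
    ((Ψ i).coeff 0) fun n => ?_).2
  simp only [AffLinForm.eval, Fin.sum_univ_one]
  linear_combination (-1 : ℤ) * h

/-- The size bound `‖Ψ‖_N ≤ L` bounds every constant term: `|ψ_k(0)| ≤ L N` (`N ≥ 1`).
[cite: GreenTao2010, (1.1)] -/
theorem natAbs_const_le_of_affLinSize_le {d s : ℕ} {Ψ : Fin s → AffLinForm d} {N L : ℕ}
    (hN : 0 < N) (h : affLinSize Ψ N ≤ L) (k : Fin s) : ((Ψ k).const).natAbs ≤ L * N := by
  have h1 : |((Ψ k).const : ℝ) / N| ≤ ∑ i, |((Ψ i).const : ℝ) / N| :=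
    Finset.single_le_sum (f := fun i => |((Ψ i).const : ℝ) / N|) (fun _ _ => abs_nonneg _)
      (Finset.mem_univ k)
  have h2 : ∑ i, |((Ψ i).const : ℝ) / N| ≤ affLinSize Ψ N :=
    le_add_of_nonneg_left (Finset.sum_nonneg fun _ _ => Finset.sum_nonneg fun _ _ => abs_nonneg _)
  have hN' : (0 : ℝ) < N := by exact_mod_cast hN
  have h3 : |((Ψ k).const : ℝ)| ≤ L * N := by
    have := h1.trans (h2.trans h)
    rwa [abs_div, Nat.abs_cast, div_le_iff₀ hN'] at this
  have h4 : (((Ψ k).const).natAbs : ℝ) ≤ L * N := by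
    rw [Nat.cast_natAbs, Int.cast_abs]
    exact h3
  exact_mod_cast h4

/-- `Δ ≤ L (2 L² N)^t` from `|a_k| ≤ L`, `|b_k| ≤ L N`. [folklore] -/
theorem crossDisc_le (Ψ : Fin (t + 1) → AffLinForm 1) {N L : ℕ} (hN : 0 < N)
    (hL : affLinSize Ψ N ≤ L) (i : Fin (t + 1)) :
    ((Ψ i).coeff 0).natAbs * ∏ k : Fin t, ((Ψ i).coeff 0 * (Ψ (i.succAbove k)).const -
      (Ψ (i.succAbove k)).coeff 0 * (Ψ i).const).natAbs ≤ L * (2 * L ^ 2 * N) ^ t := by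
  have ha : ∀ k, ((Ψ k).coeff 0).natAbs ≤ L := fun k => natAbs_coeff_le_of_affLinSize_le hL k 0
  have hb : ∀ k, ((Ψ k).const).natAbs ≤ L * N := fun k =>
    natAbs_const_le_of_affLinSize_le hN hL k
  refine Nat.mul_le_mul (ha i) ?_
  calc ∏ k : Fin t, ((Ψ i).coeff 0 * (Ψ (i.succAbove k)).const -
        (Ψ (i.succAbove k)).coeff 0 * (Ψ i).const).natAbs
      ≤ ∏ _k : Fin t, (2 * L ^ 2 * N) := Finset.prod_le_prod (fun k _ => Nat.zero_le _) fun k _ => ?_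
    _ = (2 * L ^ 2 * N) ^ t := by rw [Finset.prod_const, Finset.card_univ, Fintype.card_fin]
  calc ((Ψ i).coeff 0 * (Ψ (i.succAbove k)).const -
        (Ψ (i.succAbove k)).coeff 0 * (Ψ i).const).natAbs
      ≤ ((Ψ i).coeff 0 * (Ψ (i.succAbove k)).const).natAbs +
          ((Ψ (i.succAbove k)).coeff 0 * (Ψ i).const).natAbs := Int.natAbs_sub_le _ _
    _ = ((Ψ i).coeff 0).natAbs * ((Ψ (i.succAbove k)).const).natAbs +
          ((Ψ (i.succAbove k)).coeff 0).natAbs * ((Ψ i).const).natAbs := by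
        rw [Int.natAbs_mul, Int.natAbs_mul]
    _ ≤ L * (L * N) + L * (L * N) :=
        add_le_add (Nat.mul_le_mul (ha _) (hb _)) (Nat.mul_le_mul (ha _) (hb _))
    _ = 2 * L ^ 2 * N := by ring

/-- `log log N^{t+1} ≤ t + log log N` for `log N ≥ 1` (`log (t+1) ≤ t`). [folklore] -/
theorem loglog_pow_le {N : ℕ} (hN : 1 ≤ Real.log N) (t : ℕ) :
    Real.log (Real.log (((N ^ (t + 1) : ℕ) : ℝ))) ≤ t + Real.log (Real.log N) := by
  have ht : (0 : ℝ) < t + 1 := by positivity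
  have hlog : Real.log ((t : ℝ) + 1) ≤ t := by
    have := Real.log_le_sub_one_of_pos ht
    linarith
  push_cast
  rw [Real.log_pow, Nat.cast_add, Nat.cast_one, Real.log_mul ht.ne' (by linarith)]
  linarith

end SingularRatio

open SingularRatio in
/-- **`stub_singularRatio`** (registered stub of the line `section-annihilator`): the
singular-series bookkeeping `SingularRatioBound` — for non-degenerate `(t+1)`-form systems of size
`≤ L`, both `𝔖(Ψ₋ᵢ)` and `𝔖(Ψ)` are `≥ 0` and `𝔖(Ψ) ≤ C (log log N)^D 𝔖(Ψ₋ᵢ)` for `N ≥ N₀(t, L)`,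
with `C = 3⁹ + 4e⁵(t+1)`, `D = 1`. [cite: GreenTao2010, Lemma 1.3] -/
theorem stub_singularRatio : SingularRatioBound := by
  intro t L
  refine ⟨3 ^ 9 + 4 * Real.exp 5 * (t + 1), by positivity, 1,
    ⌈Real.exp (Real.exp 1)⌉₊ + 8 + L * (2 * L ^ 2) ^ t, fun N hN Ψ hΨ hL i => ?_⟩
  have hΨ' := isNondegenerateSystem_removeNth hΨ i
  refine ⟨singularProduct_nonneg hΨ', singularProduct_nonneg hΨ, ?_⟩
  -- unpacking `N ≥ N₀`
  have hN8 : 8 ≤ N := le_trans (by omega) hN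
  have hNe : ⌈Real.exp (Real.exp 1)⌉₊ ≤ N := le_trans (by omega) hN
  have hNL : L * (2 * L ^ 2) ^ t ≤ N := le_trans (by omega) hN
  have hNpos : 0 < N := by omega
  have hNr : (0 : ℝ) < N := by exact_mod_cast hNpos
  have hlogN : Real.exp 1 ≤ Real.log N :=
    (Real.le_log_iff_exp_le hNr).mpr (Nat.ceil_le.mp hNe)
  have hlogN1 : 1 ≤ Real.log N := le_trans (by linarith [Real.add_one_le_exp (1 : ℝ)]) hlogN
  have hll : 1 ≤ Real.log (Real.log N) :=
    (Real.le_log_iff_exp_le (by linarith)).mpr hlogN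
  -- the integer `Δ`
  have hΔ0 := crossDisc_ne_zero Ψ hΨ i
  have hΔle := crossDisc_le Ψ hNpos hL i
  set Δ : ℕ := ((Ψ i).coeff 0).natAbs * ∏ k : Fin t, ((Ψ i).coeff 0 * (Ψ (i.succAbove k)).const -
      (Ψ (i.succAbove k)).coeff 0 * (Ψ i).const).natAbs with hΔdef
  have hΔa : ((Ψ i).coeff 0).natAbs ∣ Δ := Dvd.intro _ rfl
  have hΔD : ∀ k : Fin t, ((Ψ i).coeff 0 * (Ψ (i.succAbove k)).const -
      (Ψ (i.succAbove k)).coeff 0 * (Ψ i).const).natAbs ∣ Δ := fun k =>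
    (Finset.dvd_prod_of_mem _ (Finset.mem_univ k)).mul_left _
  have hmain := singularProduct_le Ψ hΨ i hΔ0 hΔa hΔD
  -- `Δ ≤ 2 N^{t+1}` and Landau's bound
  have hΔN : Δ ≤ 2 * N ^ (t + 1) := by
    calc Δ ≤ L * (2 * L ^ 2 * N) ^ t := hΔle
      _ = L * (2 * L ^ 2) ^ t * N ^ t := by rw [mul_pow, mul_assoc]
      _ ≤ N * N ^ t := Nat.mul_le_mul_right _ hNL
      _ = N ^ (t + 1) := by rw [pow_succ, mul_comm]
      _ ≤ 2 * N ^ (t + 1) := by omega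
  have hpow8 : 8 ≤ N ^ (t + 1) := le_trans hN8 (Nat.le_self_pow (by omega) N)
  have hφ := BrunGoldbach.self_div_totient_le (Nat.one_le_iff_ne_zero.mpr hΔ0) hΔN hpow8
  have hlp := loglog_pow_le hlogN1 t
  have e5 := Real.exp_pos 5
  have hratio : (Δ : ℝ) / Nat.totient Δ ≤
      (3 ^ 9 + 4 * Real.exp 5 * (t + 1)) * Real.log (Real.log N) ^ 1 := by
    rw [pow_one]
    have h1 : 4 * Real.exp 5 * Real.log (Real.log (((N ^ (t + 1) : ℕ) : ℝ))) ≤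
        4 * Real.exp 5 * (t + Real.log (Real.log N)) := by
      exact mul_le_mul_of_nonneg_left hlp (by positivity)
    nlinarith [mul_nonneg (mul_nonneg e5.le (Nat.cast_nonneg t)) (sub_nonneg.mpr hll),
      mul_nonneg e5.le (sub_nonneg.mpr hll)]
  calc singularProduct Ψ ≤ (Δ : ℝ) / Nat.totient Δ * singularProduct (Fin.removeNth i Ψ) := hmain
    _ ≤ (3 ^ 9 + 4 * Real.exp 5 * (t + 1)) * Real.log (Real.log N) ^ 1 *
          singularProduct (Fin.removeNth i Ψ) :=
        mul_le_mul_of_nonneg_right hratio (singularProduct_nonneg hΨ')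

end Summit.Parity.GeneralizedHardyLittlewood.Cruxes.CellParityLaw.SectionAnnihilator

end
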